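import Literature.MathematicalPhysics.QuantumFieldTheory.Balaban1983to89.B5Leaf235Torus

/-!
# B4 Lemma 2.4 (2.36) — the HÖLDER QUOTIENT of the kernel of `∂^{L^{−j}}_μ G_j Q_j^*` — ON THE TORUS for Bałaban's concrete
# scalar tower: the tower's quotient IS b04's descended Hölder multiplier `torusKernelH248`, and its decay with the rate
# chosen BEFORE the exponent `α`

statement-level skeleton of published theorems with citation tags; proofs where landed; nothing here is a claim about the
Yang–Mills mass gap

B4 = [2] of B5 = T. Bałaban, *Regularity and decay of lattice Green's functions*, Commun. Math. Phys. **89** (1983) 571–597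
[cite: Balaban1983RegularityDecay] (journal page = PDF page + 570; held `paper:balaban1983-cmp89-regularity-decay`, pages
p0002, p0012, p0015, p0016 materialised and read by this seat); B5 = T. Bałaban, *Propagators and renormalization
transformations for lattice gauge theories. I*, Commun. Math. Phys. **95** (1984) 17–40 [cite: Balaban1984PropagatorsI]
(journal page = PDF page + 16; held `paper:balaban1984-cmp95-propagators-rt-i`, p0023 read).  Cell `lit-balaban` (Phase-2
proof seat p38 gen 4), programme «[2]'s Theorem on the torus at A = 0» for the B5 Prop. 1.2 census of the B5 fold owner
(HOME `ROWS-B5.md` row B5.Prop1.2, v2.18/v2.20): file F1a.  Companion F1b = `B4Lemma24TorusScales` (the torus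
`B4.ScaleSetting` family and the typed leaf with `0 ≤ α < 1` by name).

## The printed step

* B4 p. 582 [PDF 12]: *"Lemma 2.4. There exist positive constants c₀, δ₀, and for α<1, there exists a constant c₁, such
  that |(G_j(□)Q_j^*)(x, y)|, |(∂^{L^{−j}}_μ G_j(□)Q_j^*)(x, y)| ≤ c₀e^{−δ₀|x−y|}, (2.35)
  (1/|x−x′|^α)|(∂^{L^{−j}}_μ G_j(□)Q_j^*)(x, y) − (∂^{L^{−j}}_μ G_j(□)Q_j^*)(x′, y)| ≤ c₁e^{−δ₀dist({x,x′},y)}, (2.36)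
  |C^{(j)}(□; y, y′)| ≤ c₀e^{−δ₀|y−y′|}, (2.37) for arbitrary non-negative integer j, arbitrary, rectangular parallelepiped
  □ ⊂ L^{−j}Z^d built of large blocks, and x, x′ ∈ □, y, y′ ∈ □^{(j)} = □∩Z^d."* — THIS FILE: the quantity (2.36), on the
  whole torus.  Quantifier order as printed: `c₀, δ₀` BEFORE `α`, `c₁` after it; p. 586 [PDF 16], end of the proof:
  *"the constant depends on α<1. (2.51)"* and *"It is more troublesome, but equally elementary, to prove that this
  neighbourhood can be chosen independently of j"*.
* B4 p. 572 [PDF 2]: *"Another common case is to consider operators on subsets of a torus T_η which we identify with a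
  rectangular parallelepiped in ηZ^d with periodic conditions."*; B5 p. 39 [PDF 23]: *"We use Lemma 2.4 of that paper and
  the equality (2.34) with □ replaced by the whole torus."* — the torus is the case B5 (and B6) consume.
* The Fourier side of (2.36) is kernel-proved by the b04 lineage: `B4StripSumsHolder.GH` (the Hölder multiplier, (2.49)
  regrouped), `stripRegular_GH`, `torusKernelH248` and `hkernel248_torusKernel_decay_torusMetric` (*"proof supplied by the
  audit along the printed method"*), whose HONEST SCOPE left the identification of `torusKernelH248` with the Hölder quotient
  of a concrete OPERATOR to the consumer — supplied here, exactly as `B5Leaf235Torus` §1–§2 did for the derivative kernel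
  `torusKernelD248` (its NOT-CERTIFIED (c): *"The Hölder quantity (2.36): not here"*).

## What this module does (all for Bałaban's concrete scalar torus tower `B1RG242Torus.tower`, U = 1, whole torus)

* §1 (Fourier side) `PhZ_add`; `GDfull_add` (the differentiated `l`-sum at the shifted fine point `z + σ`); `GH_eq_GDfull`:
  `GH_{α,n,z mod n,μ,σ}(p′) = (n/|σ|_∞)^α e^{−ip′·⌊z/n⌋}(GDfull(z+σ) − GDfull(z))`; the fine-point Hölder kernel
  `KTH α n a m² μ N z σ y := torusKernelH248 α n a m² (z mod n) μ σ N (⌊z/n⌋ − y)` and **`KTH_eq_sub`**: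
  `K_T^{H,α,μ}(z, σ; y) = (n/|σ|_∞)^α·(K_T^{∂,μ}(z + σ, y) − K_T^{∂,μ}(z, y))` with `K_T^{∂,μ} = B5Leaf235Torus.KTD` — for every
  `σ`; `KTD_translate_left` (periodicity of `K_T^{∂,μ}` in the fine point).
* §2 (tower side, one volume `P = mkP d′ L m K`) `T_eq_torusSupNorm` (the tower metric IS b04's `torusSupNorm`); the centred
  difference `cdiff x x′` of two fine sites with `supNorm_cdiff : |σ|_∞ = |x − x′|_{T^{(0)}}`, `abs_cdiff_le`, `cdiff_ne_zero`;
  `K1_eq_KTD_cdiff`: `K1_j(μ; x′, y) = K_T^{∂,μ}(rep x + σ, rep y)`; **`holderQuot_eq_KTH`**: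
  `(L^j/|x−x′|_{T^{(0)}})^α (K1_j(μ;x′,y) − K1_j(μ;x,y)) = K_T^{H,α,μ}(rep x, σ; rep y)`.
* §3 `DecayHypH` / **`decayHypH_exists`**: ONE `κ > 0` (b04's `min κ₁ (rOf (d′+1))`, `κ₁` from
  `B4StripCauchy.uniformStrip_holds`, independent of `α`) such that for every `0 ≤ α < 1` some `M(α) ≥ 0` bounds
  `‖torusKernelH248 α …‖ ≤ M·C(κ,d′)·e^{−κ/(d′+1)|x⁰|_T}` uniformly in the mesh, the window `a_j ∈ [a(1−L^{−2}), a]`,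
  `m_j² ∈ [0, m²₊]`, the offset, the direction, `0 < |σ|_∞ ≤ n` and the volume (proof text = b04's
  `hkernel248_torusKernel_decay_torusMetric` with the `obtain` of `uniformStrip_holds` moved in front of `α`, as
  `B4Lemma24ZeroBoxScale.hkernel248_decay_unif` does for the lattice kernel); **`holder_near_bound_of`** (pairs with
  `|x − x′|_{T^{(0)}} ≤ L^j`, i.e. `|x − x′| ≤ 1` in level-`j` units: `(L^j/|x−x′|)^α|K1_j(x′,y) − K1_j(x,y)| ≤
  c13·e^{−κ/(d′+1)·d_{XU}(x,(j,y))}`) and **`holder_far_bound_of`** (`|x − x′| > 1`: weight `≤ 1`, triangle inequality with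
  (2.35) through `B5Leaf235Torus.K13_bound_of`: `≤ 2c13·e^{−κ/(d′+1)·min(d_{XU}(x,y), d_{XU}(x′,y))}`).

## Dictionary / HONEST SCOPE

(i) ξ-units: level `j`, mesh `n = L^j`, fine sites `x ∈ T^{(0)} = Site P 0` with representatives `rep x ∈ ℤ^{d′+1}`, unit
sites `y ∈ T^{(j)}`; the printed `|x − x′|` (units of the level-`j` unit lattice) is `L^{−j}|x − x′|_{T^{(0)}}` with the sup
torus metric `B5Ineq137Torus.T` (B4 does not fix ℓ¹/ℓ²/ℓ^∞; constants are dimension-dependent anyway), so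
`|x − x′|^{−α} = (L^j/|x−x′|_{T^{(0)}})^α`; `dist({x,x′},y)` is read `min(d_{XU}(x,(j,y)), d_{XU}(x′,(j,y)))` with
`B5Ineq137Torus.dXU` (corner representative of `y`), as `B5Leaf235Torus` reads `|x − y|`.  (ii) The separation numerator of
the torus pair is the CENTRED representative `σ` of `rep x′ − rep x` (`B4TorusKernel.MultiPeriod.centreVec`), so that
`|σ|_∞` is the torus distance and `rep x + σ` a period-translate of `rep x′`.  (iii) Window and cap as in `B4Ineq116Torus` /
`B5Leaf235Torus`: `a_j ∈ [a(1 − L^{−2}), a]`, `(L^jε)²m² ≤ m²₊`.  (iv) Only `0 ≤ α < 1` (the Hölder range of (2.14) p. 577;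
the literal `α < 0` instances of the typed leaf fail on boxes, `B4Lemma24ZeroBoxAlphaNeg`, and are not claimed).  (v)
Constants are explicit functions of b04's existential `(κ₁, c)` — no numerical values.

## NOT-CERTIFIED

Regions □ other than the whole torus (Neumann parallelepipeds via the reflections (2.42): pv17 `B4Green242Bridge` /
`B4Lemma24ZeroBoxScale` for boxes); U ≠ 1 / background field; the uniform family statement and the typed leaf by name
(companion `B4Lemma24TorusScales`).

## DISTINCTNESS

`B4StripSumsHolder` (b04) proves the strip regularity and the torus decay of the MULTIPLIER `GH` (rate after `α` in its
statements); `B4Lemma24ZeroBoxScale` §4 (pv17) re-threads the rate for the INFINITE-LATTICE kernel and the Neumann BOX;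
`B5Leaf235Torus` identifies the DERIVATIVE kernel of the tower with `torusKernelD248`.  This file identifies the tower's
Hölder QUOTIENT with `torusKernelH248` and re-threads the rate for the TORUS kernel; it re-proves nothing of those files.
-/

namespace Literature.MathematicalPhysics.QuantumFieldTheory.Balaban1983to89

namespace B4Lemma24TorusHolder

noncomputable section

/-! ## §1 The Fourier side: b04's Hölder torus kernel `torusKernelH248` read at a fine point IS the weighted difference
`(n/|σ|_∞)^α · (K_T^{∂,μ}(z + σ, y) − K_T^{∂,μ}(z, y))` of the differentiated kernel of `B5Leaf235Torus` -/

section Fourier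

open Complex Finset
open B4ContourShift B4Strip B4StripSums B4StripSumsHolder B4Green244 B4StripSumsDeriv B4TorusGreen244 B4Torus248Decay
open B5Leaf235Torus (GDfull KTD GDfull_eq_phase_mul_GD KTD_eq_sum KTD_eq_sub)

variable {d : ℕ}

/-- one coordinate of the phase is additive in the lattice point: `e^{i(ζ+2πj)(s+t)/n} = e^{i(ζ+2πj)s/n}e^{i(ζ+2πj)t/n}`.
[folklore] -/
private theorem efZ_add (n j : ℕ) (s t : ℤ) (ζ : ℂ) : efZ n j (s + t) ζ = efZ n j s ζ * efZ n j t ζ := by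
  unfold efZ
  rw [← Complex.exp_add]
  congr 1
  push_cast; ring

/-- the full phase is additive in the lattice point: `e^{i(p′+2πk)·(z+σ)/n} = e^{i(p′+2πk)·z/n} e^{i(p′+2πk)·σ/n}`. [folklore] -/
private theorem PhZ_add (n : ℕ) (k : Fin d → Fin n) (z σ : Fin d → ℤ) (p : Fin d → ℂ) :
    PhZ n k (z + σ) p = PhZ n k z p * PhZ n k σ p := by
  unfold PhZ
  rw [← Finset.prod_mul_distrib]
  exact Finset.prod_congr rfl fun ν _ => by rw [Pi.add_apply, efZ_add]

/-- THE SHIFTED DIFFERENTIATED MULTIPLIER: at the fine point `z + σ` the `l`-sum `GDfull` is the block phase of `z` times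
the `σ`-twisted offset sum `Σ_k e^{i(p′+2πk)·σ/n} termD_k(z mod n)` — the sum b04's Hölder multiplier `GH` subtracts `GD`
from ((2.49) regrouped, `B4StripSumsHolder.termH`). [cite: Balaban1983RegularityDecay, (2.49) p.585 (regrouped by the audit)]
[folklore] -/
theorem GDfull_add (n : ℕ) [NeZero n] (a m2 : ℝ) (z σ : Fin d → ℤ) (μ : Fin d) (p : Fin d → ℂ) :
    GDfull n a m2 (z + σ) μ p
      = cexp (I * phaseC p (coarse n z)) * ∑ k : Fin d → Fin n, PhZ n k σ p * termD n a m2 (offset n z) μ k p := by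
  conv_lhs => rw [← finePt_coarse_offset n z]
  unfold GDfull termD term F V
  rw [Finset.mul_sum]
  refine Finset.sum_congr rfl fun k _ => ?_
  rw [PhZ_add, PhZ_finePt n (NeZero.ne n), Finset.prod_mul_distrib]
  ring

/-- b04's Hölder multiplier in terms of the full multiplier: `GH_{α,n,a,m²,z mod n,μ,σ}(p′) = (n/|σ|_∞)^α e^{−ip′·⌊z/n⌋}
(GDfull(z + σ; μ; p′) − GDfull(z; μ; p′))`. [cite: Balaban1983RegularityDecay, (2.36) p.582 with (2.49) p.585; dictionary]
[folklore] -/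
theorem GH_eq_GDfull (α : ℝ) (n : ℕ) [NeZero n] (a m2 : ℝ) (z σ : Fin (d + 1) → ℤ) (μ : Fin (d + 1))
    (p : Fin (d + 1) → ℂ) :
    GH α n a m2 (offset n z) μ σ p
      = ((((n : ℝ) / supNorm σ) ^ α : ℝ) : ℂ) * (cexp (-(I * phaseC p (coarse n z))) *
          (GDfull n a m2 (z + σ) μ p - GDfull n a m2 z μ p)) := by
  unfold GH
  congr 1
  have hsplit : ∑ k : Fin (d + 1) → Fin n, termH n a m2 (offset n z) μ σ k p
      = ∑ k : Fin (d + 1) → Fin n, PhZ n k σ p * termD n a m2 (offset n z) μ k p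
          - ∑ k : Fin (d + 1) → Fin n, termD n a m2 (offset n z) μ k p := by
    rw [← Finset.sum_sub_distrib]
    exact Finset.sum_congr rfl fun k _ => by unfold termH; ring
  rw [hsplit, GDfull_add, GDfull_eq_phase_mul_GD]
  unfold GD
  rw [mul_sub, ← mul_assoc, ← mul_assoc, ← Complex.exp_add, neg_add_cancel, Complex.exp_zero, one_mul, one_mul]

/-- THE FINITE-TORUS HÖLDER KERNEL READ AT FINE POINTS: `K_T^{H,α,μ}(z, σ; y) := torusKernelH248 α n a m² (z mod n) μ σ N
(⌊z/n⌋ − y)` — b04's `torusKernelH248` (the descended Hölder multiplier) in the fine-point reading of `B4TorusGreen244.KT` /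
`B5Leaf235Torus.KTD` (base point `z ∈ ℤ^{d+1}`, separation numerator `σ ∈ ℤ^{d+1}`, unit point `y`).
[cite: Balaban1983RegularityDecay, (2.36) p.582 with (2.49) p.585 and p.572 (torus); dictionary] [folklore] -/
def KTH (α : ℝ) (n : ℕ) [NeZero n] (a m2 : ℝ) (μ : Fin (d + 1)) (N : Fin (d + 1) → ℕ)
    (z σ y : Fin (d + 1) → ℤ) : ℂ :=
  torusKernelH248 α n a m2 (offset n z) μ σ N (coarse n z - y)

/-- `torusKernelH248` written with `dualMomentum` (definitional). [folklore] -/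
private theorem torusKernelH248_eq_dual (α : ℝ) (n : ℕ) [NeZero n] (a m2 : ℝ) (τ : Fin (d + 1) → Fin n) (μ : Fin (d + 1))
    (σ : Fin (d + 1) → ℤ) (N : Fin (d + 1) → ℕ) (x : Fin (d + 1) → ℤ) :
    torusKernelH248 α n a m2 τ μ σ N x = (∏ i, ((N i : ℕ) : ℂ))⁻¹ * ∑ k : (i : Fin (d + 1)) → Fin (N i),
      GH α n a m2 τ μ σ (ofRealVec (dualMomentum N k)) * UnitAddTorus.mFourier x (B4TorusKernel.MultiPeriod.gridPt N k) :=
  rfl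

/-- **THE HÖLDER KERNEL IS THE WEIGHTED DIFFERENCE OF THE DERIVATIVE KERNEL**: `K_T^{H,α,μ}(z, σ; y) = (n/|σ|_∞)^α ·
(K_T^{∂,μ}(z + σ, y) − K_T^{∂,μ}(z, y))` — b04's `torusKernelH248` is LITERALLY the `|ξσ|_∞^{−α}`-weighted difference, in
the fine variable, of b04's `torusKernelD248` read at fine points (`B5Leaf235Torus.KTD`), for EVERY `σ` (the restriction
`0 < |σ|_∞ ≤ n` enters only the decay estimate). [cite: Balaban1983RegularityDecay, (2.36) p.582, (2.49) p.585 with p.572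
(torus); dictionary] [folklore] -/
theorem KTH_eq_sub (α : ℝ) (n : ℕ) [NeZero n] (a m2 : ℝ) (μ : Fin (d + 1)) (N : Fin (d + 1) → ℕ)
    (z σ y : Fin (d + 1) → ℤ) :
    KTH α n a m2 μ N z σ y
      = ((((n : ℝ) / supNorm σ) ^ α : ℝ) : ℂ) * (KTD n a m2 μ N (z + σ) y - KTD n a m2 μ N z y) := by
  unfold KTH
  rw [torusKernelH248_eq_dual, KTD_eq_sum, KTD_eq_sum, ← Finset.sum_sub_distrib, Finset.mul_sum, Finset.mul_sum]
  refine Finset.sum_congr rfl fun k _ => ?_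
  rw [mFourier_gridPt, GH_eq_GDfull, phaseC_sub, mul_sub I, Complex.exp_sub, Complex.exp_neg, Complex.exp_neg]
  have hz : cexp (I * phaseC (ofRealVec (dualMomentum N k)) (coarse n z)) ≠ 0 := Complex.exp_ne_zero _
  have hy : cexp (I * phaseC (ofRealVec (dualMomentum N k)) y) ≠ 0 := Complex.exp_ne_zero _
  field_simp

/-- `(nN_μ)_μ`-PERIODICITY OF THE DERIVATIVE KERNEL in the fine point: `K_T^{∂,μ}(z + (nN_νm_ν)_ν, y) = K_T^{∂,μ}(z, y)`
(from `B4TorusGreen244.KT_translate_left` through `B5Leaf235Torus.KTD_eq_sub`). [folklore] -/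
private theorem KTD_translate_left (n : ℕ) [NeZero n] (a m2 : ℝ) (μ : Fin (d + 1)) {N : Fin (d + 1) → ℕ} (hN : ∀ i, 1 ≤ N i)
    (z y m : Fin (d + 1) → ℤ) :
    KTD n a m2 μ N (B4TorusKernel.MultiPeriod.translate (fun i => n * N i) z m) y = KTD n a m2 μ N z y := by
  have h : B4TorusKernel.MultiPeriod.translate (fun i => n * N i) z m + e μ
      = B4TorusKernel.MultiPeriod.translate (fun i => n * N i) (z + e μ) m := by
    funext i
    simp only [Pi.add_apply, B4TorusKernel.MultiPeriod.translate_apply]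
    ring
  rw [KTD_eq_sub, KTD_eq_sub, h, KT_translate_left n a m2 hN, KT_translate_left n a m2 hN]

end Fourier

/-! ## §2 The tower side: the Hölder quotient of `K1_j = ∂^{L^{−j}}_μ G_j^{resc}Q_j^*` between two fine torus sites is the
Hölder kernel `K_T^{H,α,μ}` at the CENTRED representative of their difference -/

section Tower

open Matrix B1RG242Torus B5Display136Torus B5Leaf237C0Torus B4Ineq115Torus B5Ineq137Torus B4Ineq116Torus
open B4ContourShift (supNorm supNorm_nonneg abs_le_supNorm)
open B4Green244 (coarse offset e)
open B5Leaf235Torus (KTD K1_eq_KTD)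
open B4TorusKernel.MultiPeriod (torusSupNorm translate centreVec supNorm_translate_centreVec translate_apply)

variable (d' Lb mb Kb : ℕ) (hL : Odd Lb ∧ 1 < Lb) [NeZero Lb]

local notation "Pm" => mkP d' Lb mb Kb hL

omit [NeZero Lb] in
/-- THE METRIC DICTIONARY, EQUALITY: the tower's sup torus distance `T^{(i)}` IS the torus sup norm of
`B4TorusKernel.MultiPeriod` on the difference of representatives (`B4Ineq116Torus.T_le_torusSupNorm` is `≤`). [folklore] -/
private theorem T_eq_torusSupNorm {i : ℕ} (y' y : Site Pm i) :
    T Pm i y' y = torusSupNorm (Nv Pm i) (rep Pm y' - rep Pm y) := by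
  refine le_antisymm (T_le_torusSupNorm d' Lb mb Kb hL y' y) (Finset.sup'_le _ _ fun i₀ _ => ?_)
  have h := B4Sect5Torus.circAbs_le_tdist (Nv_pos Pm i) (toT y') (toT y) i₀
  exact h

/-- THE CENTRED DIFFERENCE of two fine torus sites: the representative `σ ∈ ℤ^{d′+1}` of `rep x′ − rep x (mod |T^{(0)}|)`
with `|σ_ν| ≤ |T^{(0)}|/2`, i.e. the shortest lattice vector from `x` to `x′` around the torus. [folklore] -/
def cdiff (x x' : Site Pm 0) : Fin (d' + 1) → ℤ :=
  translate (Nv Pm 0) (rep Pm x' - rep Pm x) (centreVec (Nv Pm 0) (rep Pm x' - rep Pm x))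

omit [NeZero Lb] in
/-- `|σ|_∞ = |x − x′|_{T^{(0)}}`: the centred difference realises the torus distance. [folklore] -/
private theorem supNorm_cdiff (x x' : Site Pm 0) : supNorm (cdiff d' Lb mb Kb hL x x') = T Pm 0 x x' := by
  unfold cdiff
  rw [supNorm_translate_centreVec (Nv_pos Pm 0), T_symm, T_eq_torusSupNorm]

omit [NeZero Lb] in
/-- `|σ_ν| ≤ |x − x′|_{T^{(0)}}` coordinatewise. [folklore] -/
private theorem abs_cdiff_le (x x' : Site Pm 0) (ν : Fin (d' + 1)) :
    |cdiff d' Lb mb Kb hL x x' ν| ≤ T Pm 0 x x' := by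
  have h := abs_le_supNorm (cdiff d' Lb mb Kb hL x x') ν
  rw [supNorm_cdiff] at h
  exact_mod_cast h

omit [NeZero Lb] in
/-- `σ ≠ 0` for `x ≠ x′`. [folklore] -/
private theorem cdiff_ne_zero {x x' : Site Pm 0} (hne : x' ≠ x) : cdiff d' Lb mb Kb hL x x' ≠ 0 := by
  intro h0
  apply hne
  have hs : supNorm (cdiff d' Lb mb Kb hL x x') ≤ 0 := by
    rw [h0]
    exact Finset.sup'_le _ _ fun i _ => by simp
  have hT : T Pm 0 x x' = 0 := le_antisymm (by rw [← supNorm_cdiff]; exact hs) (T_nonneg Pm 0 x x')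
  exact (eq_of_T_eq_zero (P := Pm) hT).symm

omit [NeZero Lb] in
/-- `rep x + σ` is a translate of `rep x′` by the period of `T^{(0)}` written as `L^j · |T^{(j)}|` per direction. [folklore] -/
private theorem rep_add_cdiff {j : ℕ} (hj : j ≤ mb + Kb) (x x' : Site Pm 0) :
    rep Pm x + cdiff d' Lb mb Kb hL x x'
      = translate (fun i => (Pm).L ^ j * Nv Pm j i) (rep Pm x') (centreVec (Nv Pm 0) (rep Pm x' - rep Pm x)) := by
  have h0 : (Pm).sitesPerDir 0 = (Pm).L ^ j * (Pm).sitesPerDir j := by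
    rw [sitesPerDir_zero_eq Pm j, lvl_of_le Pm hj]
  funext i
  simp only [cdiff, Pi.add_apply, Pi.sub_apply, translate_apply, Nv, h0]
  ring

/-- **THE SHIFTED DERIVATIVE KERNEL**: for `a > 0`, `m² ≥ 0`, `1 ≤ j ≤ m + K`,
`K1_j(μ; x′, y) = K_T^{∂,μ}(rep x + σ, rep y)` with `σ` the centred difference of `x, x′` — `B5Leaf235Torus.K1_eq_KTD` at
`x′` and the `(L^j|T^{(j)}|)`-periodicity of the kernel column in the fine point. [cite: Balaban1983RegularityDecay, (2.35)
p.582 with (2.48)–(2.49) p.585 and p.572 (torus); dictionary] [folklore] -/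
theorem K1_eq_KTD_cdiff {a msq : ℝ} (ha : 0 < a) (hm : 0 ≤ msq) {j : ℕ} (hj1 : 1 ≤ j) (hj : j ≤ mb + Kb)
    (μ : Fin (d' + 1)) (x x' : Site Pm 0) (y : Site Pm j) :
    ((K1 Pm a msq j μ x' ⟨j, y⟩ : ℝ) : ℂ)
      = KTD ((Pm).L ^ j) (B1.aSeq a Lb j) ((Pm).spacing j ^ 2 * msq) μ (Nv Pm j)
          (rep Pm x + cdiff d' Lb mb Kb hL x x') (rep Pm y) := by
  rw [K1_eq_KTD d' Lb mb Kb hL ha hm hj1 hj μ x' y, rep_add_cdiff d' Lb mb Kb hL hj,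
    KTD_translate_left _ _ _ μ (Nv_pos Pm j)]

omit [NeZero Lb] in
/-- `(L^j : ℝ) = ((L^j : ℕ) : ℝ)` bookkeeping for the mesh `n = L^j` of level `j`. [folklore] -/
private theorem cast_L_pow (j : ℕ) : ((((Pm).L ^ j : ℕ) : ℝ)) = ((Pm).L : ℝ) ^ j := by push_cast; rfl

/-- **THE HÖLDER QUOTIENT OF THE TOWER IS THE HÖLDER TORUS KERNEL.**  For `a > 0`, `m² ≥ 0`, `1 ≤ j ≤ m + K`, fine sites
`x, x′ ∈ T^{(0)}`, unit site `y ∈ T^{(j)}`: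
`(L^j/|x−x′|_{T^{(0)}})^α · ((∂^{L^{−j}}_μG_jQ_j^*)(x′,y) − (∂^{L^{−j}}_μG_jQ_j^*)(x,y)) = K_T^{H,α,μ}(rep x, σ; rep y)` with `σ`
the centred difference — i.e. the printed quotient `|x − x′|^{−α}[…]` of (2.36) (distances in the units of the level-`j`
unit lattice: `|x − x′| = L^{−j}|x − x′|_{T^{(0)}}`) is the value of b04's descended Hölder multiplier.
[cite: Balaban1983RegularityDecay, Lemma 2.4 (2.36) p.582 with (2.49) p.585 and p.572 (torus); dictionary] [folklore] -/
theorem holderQuot_eq_KTH {a msq : ℝ} (ha : 0 < a) (hm : 0 ≤ msq) {j : ℕ} (hj1 : 1 ≤ j) (hj : j ≤ mb + Kb)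
    (α : ℝ) (μ : Fin (d' + 1)) (x x' : Site Pm 0) (y : Site Pm j) :
    (((((Pm).L : ℝ) ^ j / T Pm 0 x x') ^ α * (K1 Pm a msq j μ x' ⟨j, y⟩ - K1 Pm a msq j μ x ⟨j, y⟩) : ℝ) : ℂ)
      = KTH α ((Pm).L ^ j) (B1.aSeq a Lb j) ((Pm).spacing j ^ 2 * msq) μ (Nv Pm j) (rep Pm x)
          (cdiff d' Lb mb Kb hL x x') (rep Pm y) := by
  rw [KTH_eq_sub, ← K1_eq_KTD_cdiff d' Lb mb Kb hL ha hm hj1 hj μ x x' y,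
    ← K1_eq_KTD d' Lb mb Kb hL ha hm hj1 hj μ x y, supNorm_cdiff, cast_L_pow]
  push_cast
  ring

end Tower

/-! ## §3 The decay of the Hölder torus kernel with the rate chosen BEFORE `α` (the print's quantifier order «There exist
positive constants c₀, δ₀, and for α<1, there exists a constant c₁»), and (2.36) at one volume and level -/

section Decay

open Complex MeasureTheory
open B4ContourShift B4Strip B4StripCauchy B4StripSums B4StripSumsHolder B5Strip145Analytic
open B4TorusKernel.MultiPeriod (torusSupNorm)

/-- The decay package of b04's Hölder torus kernel at exponent `α`, rate `κ`, constant `M`, over the window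
`a′ ∈ [a(1 − L^{−2}), a]` of the running `a_j` (`B1.ainf_lt_aSeq`, `B1.aSeq_le`) and the mass window `[0, m²₊]`:
`‖torusKernelH248 α n a′ m² τ μ σ N x⁰‖ ≤ M·C(κ,d′)·e^{−κ/(d′+1)·|x⁰|_{T}}` for every mesh `n`, offset `τ`, direction `μ`,
separation numerator `0 < |σ|_∞ ≤ n`, period vector `N ≥ 1` and block point `x⁰` (the shape of
`B4StripSumsHolder.hkernel248_torusKernel_decay_torusMetric`, cf. `B5Leaf235Torus.DecayHypD`).
[cite: Balaban1983RegularityDecay, Lemma 2.4 (2.36) p.582 with (2.49)–(2.51) pp.585–586 and p.572 (torus); dictionary] -/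
def DecayHypH (d' : ℕ) (Lb : ℕ) (a m2plus κ α M : ℝ) : Prop :=
  ∀ (n : ℕ) [NeZero n] (a' m2 : ℝ), a * (1 - ((Lb : ℝ) ^ 2)⁻¹) ≤ a' → a' ≤ a → 0 ≤ m2 → m2 ≤ m2plus →
    ∀ (τ : Fin (d' + 1) → Fin n) (μ : Fin (d' + 1)) (σ : Fin (d' + 1) → ℤ), σ ≠ 0 → (∀ ν, |σ ν| ≤ n) →
      ∀ (N : Fin (d' + 1) → ℕ), (∀ i, 1 ≤ N i) → ∀ x : Fin (d' + 1) → ℤ,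
        ‖torusKernelH248 α n a' m2 τ μ σ N x‖
          ≤ M * B4TorusKernel.periodConst κ d' * Real.exp (-(κ / (d' + 1) * torusSupNorm N x))

/-- **B4 (2.36) ON THE TORUS, FOURIER SIDE, WITH THE RATE CHOSEN BEFORE `α`.**  For `a > 0`, `L > 1` and a mass cap `m²₊`
there is ONE `κ > 0` (b04's `min κ₁ (rOf (d′+1))`, `κ₁` from `B4StripCauchy.uniformStrip_holds` — independent of `α`) such
that for every `0 ≤ α < 1` there is `M ≥ 0` (b04's `boundGH d′ α c m²₊`, «the constant depends on α<1», p. 586) with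
`DecayHypH d′ L a m²₊ κ α M`.  Proof text: b04's `hkernel248_torusKernel_decay_torusMetric` with the `obtain` of
`uniformStrip_holds` moved in front of `α` (as `B4Lemma24ZeroBoxScale.hkernel248_decay_unif` does for the lattice kernel).
[cite: Balaban1983RegularityDecay, Lemma 2.4 (2.36) p.582 with (2.49)–(2.51) pp.585–586 and p.572 (torus); proof supplied
by the audit along the printed method] -/
theorem decayHypH_exists (d' : ℕ) {Lb : ℕ} (hL1 : (1 : ℝ) < Lb) {a : ℝ} (ha : 0 < a) (m2plus : ℝ) :
    ∃ κ : ℝ, 0 < κ ∧ ∀ {α : ℝ}, 0 ≤ α → α < 1 → ∃ M : ℝ, 0 ≤ M ∧ DecayHypH d' Lb a m2plus κ α M := by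
  obtain ⟨κ₁, c, hκ₁, hc, h⟩ := uniformStrip_holds (d' + 1) (a * (1 - ((Lb : ℝ) ^ 2)⁻¹)) a m2plus
    (B4Ineq116Torus.ainf_pos ha hL1)
  refine ⟨min κ₁ (rOf (d' + 1)), lt_min hκ₁ (rOf_pos _), fun {α} hα0 hα1 =>
    ⟨boundGH d' α c (max m2plus 0), boundGH_nonneg _ α hc (le_max_right _ _), ?_⟩⟩
  intro n _ a' m2 ha1 ha2 hm hmp τ μ σ hσ0 hσn N hN x
  have hκ0 : 0 < min κ₁ (rOf (d' + 1)) := lt_min hκ₁ (rOf_pos _)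
  have hsub : Strip (d' + 1) (min κ₁ (rOf (d' + 1))) ⊆ Strip (d' + 1) κ₁ := strip_mono (min_le_left _ _)
  have hreg := stripRegular_GH n a' m2 (max m2plus 0) hm (hmp.trans (le_max_left _ _)) τ μ hσ0 hσn hα0 hα1
    hκ0.le (min_le_right _ _) hc (fun p hp => h n a' m2 ha1 ha2 hm hmp p (hsub hp))
  rw [torusKernelH248_eq_torusKernel α n a' m2 τ μ σ hreg hκ0.le N x]
  exact B4TorusKernel.MultiPeriod.torusKernel_descend_decay_torusMetric hreg hκ0 hN x

end Decay

section OneVolume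

open Matrix B1RG242Torus B5Display136Torus B5Leaf237C0Torus B4Ineq115Torus B5Ineq137Torus B4Ineq116Torus
open B4ContourShift (supNorm supNorm_nonneg abs_le_supNorm)
open B4Green244 (coarse offset e)
open B5Leaf235Torus (KTD K1_eq_KTD c13 c13_nonneg dXU_le_T_add_one)
open B4TorusKernel.MultiPeriod (torusSupNorm)

variable (d' Lb mb Kb : ℕ) (hL : Odd Lb ∧ 1 < Lb) [NeZero Lb]

local notation "Pm" => mkP d' Lb mb Kb hL

/-- **(2.36) ON THE TORUS AT ONE VOLUME, LEVEL AND EXPONENT, NEAR PAIRS** (`0 < |x − x′|_{T^{(0)}} ≤ L^j`, i.e. `|x − x′| ≤ 1`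
in the units of the level-`j` unit lattice), from the decay package:
`(L^j/|x−x′|_{T^{(0)}})^α |K1_j(μ; x′, y) − K1_j(μ; x, y)| ≤ c13·e^{−κ/(d′+1)·d_{XU}(x,(j,y))}` (`c13 = M·C(κ,d′)·e^{κ/(d′+1)}`
pays for `d_{XU} ≤ T^{(j)}(proj x, y) + 1`). [cite: Balaban1983RegularityDecay, Lemma 2.4 (2.36) p.582 with p.572 (torus);
dictionary] [folklore] -/
theorem holder_near_bound_of {a m2plus κ α M : ℝ} (ha : 0 < a) (hκ : 0 < κ) (hM : 0 ≤ M)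
    (hdec : DecayHypH d' Lb a m2plus κ α M) {msq : ℝ} (hmsq : 0 ≤ msq) {j : ℕ} (hj1 : 1 ≤ j) (hj : j ≤ mb + Kb)
    (hcap : (Pm).spacing j ^ 2 * msq ≤ m2plus) (μ : Fin (d' + 1)) {x x' : Site Pm 0} (hne : x' ≠ x)
    (hnear : T Pm 0 x x' ≤ ((Pm).L : ℝ) ^ j) (y : Site Pm j) :
    (((Pm).L : ℝ) ^ j / T Pm 0 x x') ^ α * |K1 Pm a msq j μ x' ⟨j, y⟩ - K1 Pm a msq j μ x ⟨j, y⟩|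
      ≤ c13 d' κ M * Real.exp (-(κ / (d' + 1) * dXU Pm j x ⟨j, y⟩)) := by
  have hL1 : (1 : ℝ) < Lb := by exact_mod_cast hL.2
  have h0 : (Pm).sitesPerDir 0 = (Pm).L ^ j * (Pm).sitesPerDir j := by
    rw [sitesPerDir_zero_eq Pm j, lvl_of_le Pm hj]
  haveI : NeZero ((Pm).L ^ j) := ⟨(pow_pos (Pm).L_pos j).ne'⟩
  have hC : 0 ≤ M * B4TorusKernel.periodConst κ d' := mul_nonneg hM (periodConst_nonneg hκ.le d')
  have hw : 0 ≤ (((Pm).L : ℝ) ^ j / T Pm 0 x x') ^ α :=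
    Real.rpow_nonneg (div_nonneg (pow_nonneg (Pm).cast_L_pos.le j) (T_nonneg Pm 0 x x')) α
  -- the left side is the norm of the Hölder torus kernel at the centred difference
  have e := holderQuot_eq_KTH d' Lb mb Kb hL ha hmsq hj1 hj α μ x x' y
  have hn : (((Pm).L : ℝ) ^ j / T Pm 0 x x') ^ α * |K1 Pm a msq j μ x' ⟨j, y⟩ - K1 Pm a msq j μ x ⟨j, y⟩|
      = ‖KTH α ((Pm).L ^ j) (B1.aSeq a Lb j) ((Pm).spacing j ^ 2 * msq) μ (Nv Pm j) (rep Pm x)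
          (cdiff d' Lb mb Kb hL x x') (rep Pm y)‖ := by
    rw [← e, Complex.norm_real, Real.norm_eq_abs, abs_mul, abs_of_nonneg hw]
  rw [hn]
  -- the separation numerator is admissible: `σ ≠ 0`, `|σ_ν| ≤ L^j`
  have hσn : ∀ ν, |cdiff d' Lb mb Kb hL x x' ν| ≤ (((Pm).L ^ j : ℕ) : ℤ) := by
    intro ν
    have h1 : ((|cdiff d' Lb mb Kb hL x x' ν| : ℤ) : ℝ) ≤ ((Pm).L : ℝ) ^ j :=
      (abs_cdiff_le d' Lb mb Kb hL x x' ν).trans hnear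
    have h2 : ((Pm).L : ℝ) ^ j = ((((Pm).L ^ j : ℕ) : ℤ) : ℝ) := by push_cast; rfl
    rw [h2] at h1
    exact_mod_cast h1
  have hb := hdec ((Pm).L ^ j) (B1.aSeq a (Lb : ℝ) j) ((Pm).spacing j ^ 2 * msq)
    (B1.ainf_lt_aSeq ha hL1 j hj1).le (B1.aSeq_le ha hL1 j hj1) (mul_nonneg (sq_nonneg _) hmsq) hcap
    (offset ((Pm).L ^ j) (rep Pm x)) μ (cdiff d' Lb mb Kb hL x x') (cdiff_ne_zero d' Lb mb Kb hL hne) hσn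
    (Nv Pm j) (Nv_pos Pm j) (coarse ((Pm).L ^ j) (rep Pm x) - rep Pm y)
  refine le_trans hb ?_
  have hd := dXU_le_T_add_one (P := Pm) hj x y
  unfold c13
  rw [mul_assoc (M * B4TorusKernel.periodConst κ d'), ← Real.exp_add]
  refine mul_le_mul_of_nonneg_left (Real.exp_le_exp.mpr ?_) hC
  rw [← rep_proj h0]
  have hT := T_le_torusSupNorm d' Lb mb Kb hL (Site.proj j j x) y
  have hκ' : 0 ≤ κ / (d' + 1) := by positivity
  nlinarith [mul_le_mul_of_nonneg_left hT hκ', mul_le_mul_of_nonneg_left hd hκ']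

/-- **(2.36) ON THE TORUS AT ONE VOLUME AND LEVEL, FAR PAIRS** (`|x − x′|_{T^{(0)}} > L^j`, weight `≤ 1` for `α ≥ 0`), from the
(2.35) package of the derivative kernel (`B5Leaf235Torus.DecayHypD`): `(L^j/|x−x′|)^α|K1_j(x′,y) − K1_j(x,y)| ≤ |K1_j(x′,y)| +
|K1_j(x,y)| ≤ 2·c13·e^{−κ/(d′+1)·min(d_{XU}(x,y), d_{XU}(x′,y))}` («which follow from (2.35) … by the triangle inequality», the
remark of `B4StripSumsHolder.hkernel248_decay`). [cite: Balaban1983RegularityDecay, Lemma 2.4 (2.35)–(2.36) p.582; dictionary]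
[folklore] -/
theorem holder_far_bound_of {a m2plus κ α M : ℝ} (ha : 0 < a) (hκ : 0 < κ) (hM : 0 ≤ M) (hα0 : 0 ≤ α)
    (hdec : B5Leaf235Torus.DecayHypD d' Lb a m2plus κ M) {msq : ℝ} (hmsq : 0 ≤ msq) {j : ℕ} (hj1 : 1 ≤ j)
    (hj : j ≤ mb + Kb) (hcap : (Pm).spacing j ^ 2 * msq ≤ m2plus) (μ : Fin (d' + 1)) {x x' : Site Pm 0}
    (hfar : ((Pm).L : ℝ) ^ j < T Pm 0 x x') (y : Site Pm j) :
    (((Pm).L : ℝ) ^ j / T Pm 0 x x') ^ α * |K1 Pm a msq j μ x' ⟨j, y⟩ - K1 Pm a msq j μ x ⟨j, y⟩|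
      ≤ 2 * c13 d' κ M *
          Real.exp (-(κ / (d' + 1) * min (dXU Pm j x ⟨j, y⟩) (dXU Pm j x' ⟨j, y⟩))) := by
  have hLj : 0 < ((Pm).L : ℝ) ^ j := pow_pos (Pm).cast_L_pos j
  have hT : 0 < T Pm 0 x x' := hLj.trans hfar
  have hw1 : (((Pm).L : ℝ) ^ j / T Pm 0 x x') ^ α ≤ 1 :=
    Real.rpow_le_one (div_nonneg hLj.le hT.le) ((div_le_one hT).mpr hfar.le) hα0
  have hw0 : 0 ≤ (((Pm).L : ℝ) ^ j / T Pm 0 x x') ^ α := Real.rpow_nonneg (div_nonneg hLj.le hT.le) α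
  have h1 := (B5Leaf235Torus.K13_bound_of d' Lb mb Kb hL ha hκ hM hdec hmsq hj1 hj hcap μ x y).1
  have h2 := (B5Leaf235Torus.K13_bound_of d' Lb mb Kb hL ha hκ hM hdec hmsq hj1 hj hcap μ x' y).1
  have hc : 0 ≤ c13 d' κ M := c13_nonneg d' hκ hM
  have hκ' : 0 ≤ κ / (d' + 1) := by positivity
  set m := min (dXU Pm j x ⟨j, y⟩) (dXU Pm j x' ⟨j, y⟩) with hm_def
  have e1 : Real.exp (-(κ / (d' + 1) * dXU Pm j x ⟨j, y⟩)) ≤ Real.exp (-(κ / (d' + 1) * m)) :=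
    Real.exp_le_exp.mpr (by nlinarith [min_le_left (dXU Pm j x ⟨j, y⟩) (dXU Pm j x' ⟨j, y⟩)])
  have e2 : Real.exp (-(κ / (d' + 1) * dXU Pm j x' ⟨j, y⟩)) ≤ Real.exp (-(κ / (d' + 1) * m)) :=
    Real.exp_le_exp.mpr (by nlinarith [min_le_right (dXU Pm j x ⟨j, y⟩) (dXU Pm j x' ⟨j, y⟩)])
  have habs : |K1 Pm a msq j μ x' ⟨j, y⟩ - K1 Pm a msq j μ x ⟨j, y⟩|
      ≤ 2 * c13 d' κ M * Real.exp (-(κ / (d' + 1) * m)) := by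
    calc |K1 Pm a msq j μ x' ⟨j, y⟩ - K1 Pm a msq j μ x ⟨j, y⟩|
        ≤ |K1 Pm a msq j μ x' ⟨j, y⟩| + |K1 Pm a msq j μ x ⟨j, y⟩| := abs_sub _ _
      _ ≤ c13 d' κ M * Real.exp (-(κ / (d' + 1) * m)) + c13 d' κ M * Real.exp (-(κ / (d' + 1) * m)) :=
          add_le_add (h2.trans (mul_le_mul_of_nonneg_left e2 hc)) (h1.trans (mul_le_mul_of_nonneg_left e1 hc))
      _ = 2 * c13 d' κ M * Real.exp (-(κ / (d' + 1) * m)) := by ring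
  have hrhs : 0 ≤ 2 * c13 d' κ M * Real.exp (-(κ / (d' + 1) * m)) := by positivity
  calc (((Pm).L : ℝ) ^ j / T Pm 0 x x') ^ α * |K1 Pm a msq j μ x' ⟨j, y⟩ - K1 Pm a msq j μ x ⟨j, y⟩|
      ≤ 1 * (2 * c13 d' κ M * Real.exp (-(κ / (d' + 1) * m))) :=
        mul_le_mul hw1 habs (abs_nonneg _) zero_le_one
    _ = 2 * c13 d' κ M * Real.exp (-(κ / (d' + 1) * m)) := one_mul _

end OneVolume

end

end B4Lemma24TorusHolder

end Literature.MathematicalPhysics.QuantumFieldTheory.Balaban1983to89
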